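import Summits.Ventures.HSemireg.Pad4TowerPermCovarianceStatic

/-!
# Cruxes ∕ BlochSeedDiscOne — v21's `JOB_AFLAT=1` CONSTRUCTION IS A♭_h LITERAL-WISE (kernel certificate of the translation step; anomaly lens g5, A7b)

HONEST FRAMING. Lens seat `plan-lens-HodgeAV-anomaly` g5 (director-hodge req-36, R16.51 (2)(a)), crux of record stmt-HodgeConjecture-18881
`BlochSeedDiscOne` (skeleton `Lines/birth.lean` 814a6a70c14e831a UNTOUCHED). Census-neutral: theorems ABOUT TYPED CLAUSE PREDICATES (the A2I clause
of record `Pad4TowerXresFamilies.XresA2IFires` and a verbatim transcription of the encoder patch v21); nothing here is an object, a σ, a seed or a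
census row. NOTHING HERE SAYS THAT HC ∕ HC_CM ∕ HC_AV ∕ H2 ∕ 18881 HOLDS OR FAILS (HC_CM is a displayed binder of the ladder only). No `sorry`, no
`axiom`, no `instance`, no notation, no Literature fact. The soundness of A♭_h as a necessary condition on real designs is NOT claimed (LEMMA A∪2I♭,
pencil ×1, R16.28 (2)); what is certified is WHICH FAMILY the patch emits.

WHAT. The encoder patch `xres2s.py` v21 6d314636d56012eb (s4-search-1 g25; DIFF-xres2s-v20_76f384ae-vs-v21.txt 96ce628e80c43675, 36 lines) emits
its new family `A2Ib` by running the A2I generator `gen_a2i_w` in the DUAL-0 world (`make_world(True)`: letters `(α, β) ↦ (−α, −β)` = `dualPt 0`,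
sides swapped = `MConfig.dual 0`) with `flat=True`, which changes EXACTLY the two α-ABSOLUTE expressions of `gen_a2i_w`: the direction branch
(l.531: `u := udir(Z_σ)` UNflipped, i.e. the typed `EncDir` with its sign test forced to «`0 ≤ α`») and the guard (l.563: `d ≤ c_σ` applied
unconditionally, i.e. the typed guard `0 ≤ α → d ≤ cabs` with its premise forced TRUE). §2 types that clause VERBATIM as `XresA2IFiresFlat`
(`OwnDir` for `EncDir`, unconditional guard, the other nine conjuncts of `XresA2IFires` letter for letter) and the emitted family as
**`A2IbClosed C := XresA2IClosedFlat (C.dual 0)`**. §1 shows every conjunct of the flat clause reads `α` only through DIFFERENCES (translation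
invariance `xresA2IFiresFlat_shift`), §3 that `ι_h = (translation by h) ∘ ι₀` and that on letters with `α ≤ h` (where the `h`-dual letter has
`α″ = h − α ≥ 0`) the clause of record and the flat clause AGREE (`xresA2IFires_iff_flat_of_nonneg`). Hence the two certificates:
* `a2ibFires_iff_aFlatFires` (LITERAL-WISE): for a head with `α(Z_σ) ≤ h`, v21's flat clause fires on `C^{ι₀}` at `(ι₀Z; ι₀q; ι₀N′; σ,u,f′,v)` iff the
  A2I clause of record fires on `C^{ι_h}` at `(ι_hZ; ι_hq; ι_hN′; σ,u,f′,v)` — instance for instance, same indices;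
* `a2ibClosed_iff_aFlat` (FAMILY): for a support whose letters all have `α ≤ h` (`BelowHeight h`, in particular any support in ◇_h,
  `belowHeight_of_inDiamond`), **`A2IbClosed C ↔ A2IMinusClosed (C.dual h)`** = A♭_h(C) (anomaly LEMMA A∪2I♭'s `A2IFlatClosed h C`, whose b-legs
  reading is `LemmaA2IFlat.a2iFlatFires_iff`); for every `h ≥` the support's height the right side is therefore the same family.
§4 is the `decide` smoke row on the three-cell fragment `smokeFrag8` ⊂ ◇₈ (same cells as `AFlatCovariance.smokeFrag8`): v20's dual family `A2I⁺` is
CLOSED there while v21's `A2Ib` is NOT, with exactly the two firings already certified for A♭₈ (`AFlatCovariance.smokeFrag8_probe`), now read in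
v21's own dual-0 coordinates. RESIDUAL PREMISE (unchanged since v14, not a theorem): the correspondence «python `gen_a2i_w` (v20) ≡ typed
`XresA2IFires`» (×2 s4-ref-2) — this file adds «python `gen_a2i_w(flat=True)` ≡ typed `XresA2IFiresFlat`», which is the SAME transcription with
the two patched lines read as patched.
-/

namespace Summit.Ventures.HSemireg.Pad4Tower

namespace AnomalyLens

namespace V21

open Finset

/-! ## §1 α-translations (as in `MirrorTestA9` §1, restated here so that this file imports only `Pad4TowerPermCovarianceStatic`) -/

/-- the α-translation of a letter by `t` (`β` fixed). -/
abbrev shiftPt (t : ℤ) (x : BPoint) : BPoint := (x.1 + t, x.2)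

/-- the α-translation of a cell, factorwise. -/
def shiftCell (t : ℤ) (Z : MCell) : MCell := fun f => shiftPt t (Z f)

/-- the α-translation of a two-level support (levels kept). -/
def shiftCfg (t : ℤ) (C : MConfig) : MConfig := ⟨C.lower.image (shiftCell t), C.upper.image (shiftCell t)⟩

theorem shiftCell_apply (t : ℤ) (Z : MCell) (f : Fin 4) : shiftCell t Z f = shiftPt t (Z f) := rfl

theorem shiftPt_ray (t : ℤ) (x : BPoint) (k : Fin 4) (e : ℤ) : shiftPt t (ray x k e) = ray (shiftPt t x) k e := by
  obtain ⟨a, b, c⟩ := x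
  apply Prod.ext
  · show a + e + t = a + t + e; ring
  · rfl

theorem shiftPt_fst (t : ℤ) (x : BPoint) : (shiftPt t x).1 = x.1 + t := rfl

theorem cabs_shiftPt (t : ℤ) (x : BPoint) : cabs (shiftPt t x) = cabs x := rfl

theorem shiftPt_injective (t : ℤ) : Function.Injective (shiftPt t) := by
  intro x y h
  obtain ⟨a, b, c⟩ := x; obtain ⟨a', b', c'⟩ := y
  simp only [shiftPt, Prod.mk.injEq] at h ⊢
  exact ⟨by omega, h.2⟩

theorem shiftCell_injective (t : ℤ) : Function.Injective (shiftCell t) := fun X Y e => by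
  funext f; exact shiftPt_injective t (congrFun e f)

theorem bsub_shiftPt (t : ℤ) (x y : BPoint) : bsub (shiftPt t x) (shiftPt t y) = bsub x y := by
  obtain ⟨a, b, c⟩ := x; obtain ⟨a', b', c'⟩ := y
  apply Prod.ext
  · show a + t - (a' + t) = a - a'; ring
  · rfl

theorem nullBelow_shiftPt (t : ℤ) (y x : BPoint) : NullBelow (shiftPt t y) (shiftPt t x) ↔ NullBelow y x := by
  obtain ⟨a, b, c⟩ := x; obtain ⟨a', b', c'⟩ := y
  simp only [NullBelow, add_sub_add_right_eq_sub, add_lt_add_iff_right]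

theorem isApex_shiftPt (t : ℤ) (x : BPoint) : isApex (shiftPt t x) ↔ isApex x := Iff.rfl

theorem shiftPt_eq_ray_iff (t : ℤ) (x y : BPoint) (k : Fin 4) (e : ℤ) :
    shiftPt t y = ray (shiftPt t x) k e ↔ y = ray x k e := by
  rw [← shiftPt_ray]; exact (shiftPt_injective t).eq_iff

theorem magree_shift (t : ℤ) (P Z : MCell) (σ : Fin 4) : MAgree (shiftCell t P) (shiftCell t Z) σ ↔ MAgree P Z σ :=
  ⟨fun h g hg => shiftPt_injective t (h g hg), fun h g hg => by simp only [shiftCell_apply, h g hg]⟩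

theorem magree2_shift (t : ℤ) (P Z : MCell) (g j : Fin 4) : MAgree2 (shiftCell t P) (shiftCell t Z) g j ↔ MAgree2 P Z g j :=
  ⟨fun h f h1 h2 => shiftPt_injective t (h f h1 h2), fun h f h1 h2 => by simp only [shiftCell_apply, h f h1 h2]⟩

theorem uPartner_shift (t : ℤ) (Z q : MCell) (σ k : Fin 4) :
    UPartner (shiftCell t Z) (shiftCell t q) σ k ↔ UPartner Z q σ k := by
  simp only [UPartner, magree_shift, shiftCell_apply, shiftPt_fst, add_sub_add_right_eq_sub, add_lt_add_iff_right, shiftPt_eq_ray_iff]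

theorem onULineBelowEq_shiftPt (t : ℤ) (x y : BPoint) (u : Fin 4) :
    OnULineBelowEq (shiftPt t x) (shiftPt t y) u ↔ OnULineBelowEq x y u := by
  simp only [OnULineBelowEq, add_sub_add_right_eq_sub, add_le_add_iff_right, shiftPt_eq_ray_iff]

theorem mem_shiftCfg_lower {t : ℤ} {C : MConfig} {X : MCell} : X ∈ (shiftCfg t C).lower ↔ ∃ Z ∈ C.lower, shiftCell t Z = X := by
  simp [shiftCfg, Finset.mem_image]

theorem mem_shiftCfg_upper {t : ℤ} {C : MConfig} {X : MCell} : X ∈ (shiftCfg t C).upper ↔ ∃ P ∈ C.upper, shiftCell t P = X := by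
  simp [shiftCfg, Finset.mem_image]

theorem shift_mem_shiftCfg_lower {t : ℤ} {C : MConfig} {Z : MCell} : shiftCell t Z ∈ (shiftCfg t C).lower ↔ Z ∈ C.lower := by
  rw [mem_shiftCfg_lower]
  exact ⟨fun ⟨Z', hZ', e⟩ => shiftCell_injective t e ▸ hZ', fun h => ⟨Z, h, rfl⟩⟩

theorem shift_mem_shiftCfg_upper {t : ℤ} {C : MConfig} {P : MCell} : shiftCell t P ∈ (shiftCfg t C).upper ↔ P ∈ C.upper := by
  rw [mem_shiftCfg_upper]
  exact ⟨fun ⟨P', hP', e⟩ => shiftCell_injective t e ▸ hP', fun h => ⟨P, h, rfl⟩⟩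

theorem forall_shiftCfg_upper {t : ℤ} {C : MConfig} {p : MCell → Prop} :
    (∀ P ∈ (shiftCfg t C).upper, p P) ↔ ∀ P ∈ C.upper, p (shiftCell t P) := by
  constructor
  · intro h P hP; exact h _ (shift_mem_shiftCfg_upper.mpr hP)
  · intro h X hX; obtain ⟨P, hP, rfl⟩ := mem_shiftCfg_upper.mp hX; exact h P hP

theorem forall_shiftCfg_lower {t : ℤ} {C : MConfig} {p : MCell → Prop} :
    (∀ Z ∈ (shiftCfg t C).lower, p Z) ↔ ∀ Z ∈ C.lower, p (shiftCell t Z) := by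
  constructor
  · intro h Z hZ; exact h _ (shift_mem_shiftCfg_lower.mpr hZ)
  · intro h X hX; obtain ⟨Z, hZ, rfl⟩ := mem_shiftCfg_lower.mp hX; exact h Z hZ

/-! ## §2 v21's flat clause, typed verbatim (`gen_a2i_w(W, sink, flat=True)`), and the emitted family `A2Ib` -/

/-- **v21 l.531, `flat=True`: `u := udir(Z_σ)` UNFLIPPED** — the letter sits on its OWN `u`-ray above its node, `x = (α − c)·I + c·n_u`, with NO
sign test on `α` (the clause of record's `EncDir x u` is `(0 ≤ α ∧ this) ∨ (α < 0 ∧ the flipped ray)`). Decidable. -/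
abbrev OwnDir (x : BPoint) (u : Fin 4) : Prop := x = ray (x.1 - cabs x, 0, 0) u (cabs x)

/-- **ONE v21 FLAT CLAUSE FIRES** = `Pad4TowerXresFamilies.XresA2IFires` with EXACTLY the two patched lines read as patched: conjunct 2 `OwnDir`
(l.531) instead of `EncDir`, conjunct 4 the guard `d ≤ cabs(Z_σ)` UNCONDITIONALLY (l.563: `(Z[sg][0] >= 0 or flat) and d > cabs ⇒ break`);
conjuncts 1, 3, 5–11 (head charged, `u`-partner at depth `d`, `f′ ≠ σ`, server, A2IPRES off-direction presence, `inter`, `deeper`, `W_{f′}`∕A1W,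
polluters (3b)(3d)) VERBATIM. Decidable. -/
abbrev XresA2IFiresFlat (C : MConfig) (Z q N' : MCell) (σ u f' v : Fin 4) : Prop :=
  ¬ isApex (Z σ) ∧ OwnDir (Z σ) u ∧ UPartner Z q σ u ∧ ((Z σ).1 - (q σ).1 ≤ cabs (Z σ)) ∧ f' ≠ σ ∧
    UPartner N' q f' v ∧
    (∀ P ∈ C.upper, ∀ w : Fin 4, w ≠ u → ¬ UPartner Z P σ w) ∧
    (∀ P ∈ C.upper, UPartner Z P σ u → (P σ).1 ≤ (q σ).1) ∧
    (∀ P ∈ C.upper, ¬ UPartner q P σ u) ∧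
    (∀ P ∈ C.upper, NullBelow (P f') (Z f') →
      (MAgree P Z f' ∨ ∃ g : Fin 4, g ≠ f' ∧ MAgree2 P Z f' g ∧ NullBelow (P g) (Z g)) →
        Z f' = ray (P f') v ((Z f').1 - (P f').1)) ∧
    (∀ P ∈ C.upper, (∀ g, g ≠ σ → g ≠ f' → P g = Z g) → OnULineBelowEq (P σ) (q σ) u →
      ¬ ((Z f').1 < (P f').1 ∧ (P f').1 ≤ (N' f').1 ∧ P f' = ray (Z f') v ((P f').1 - (Z f').1)) ∧
        ¬ (Effective (bsub (N' f') (P f')) ∧ Spacelike (bsub (P f') (Z f'))))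

/-- **the flat family is CLOSED** on a world `C` (no flat clause fires; heads and servers in `C.lower`, partners and escapes in `C.upper`). -/
abbrev XresA2IClosedFlat (C : MConfig) : Prop :=
  ∀ Z ∈ C.lower, ∀ q ∈ C.upper, ∀ N' ∈ C.lower, ∀ σ u f' v : Fin 4, ¬ XresA2IFiresFlat C Z q N' σ u f' v

/-- **v21's family `A2Ib` on the design `C`** (`gen_a2i_flat_w(make_world(True))`, DIFF l.621–622 ∕ 637 ∕ 652): the flat clause family evaluated
in the DUAL-0 world `C^{ι₀}` (letters negated, sides swapped) — exactly as v20's `A2I⁺` is `XresA2IClosed (C.dual 0)` (`A2IPlusClosed`). -/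
abbrev A2IbClosed (C : MConfig) : Prop := XresA2IClosedFlat (C.dual 0)

/-- every conjunct of the flat clause reads `α` through differences only: **the flat clause is translation-invariant.** -/
theorem ownDir_shiftPt (t : ℤ) (x : BPoint) (u : Fin 4) : OwnDir (shiftPt t x) u ↔ OwnDir x u := by
  have e : ((shiftPt t x).1 - cabs (shiftPt t x), (0 : ℤ), (0 : ℤ)) = shiftPt t (x.1 - cabs x, 0, 0) :=
    Prod.ext (by show x.1 + t - cabs x = x.1 - cabs x + t; ring) rfl
  show shiftPt t x = ray ((shiftPt t x).1 - cabs (shiftPt t x), 0, 0) u (cabs (shiftPt t x)) ↔ x = ray (x.1 - cabs x, 0, 0) u (cabs x)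
  rw [e, cabs_shiftPt, shiftPt_eq_ray_iff]

theorem xresA2IFiresFlat_shift (t : ℤ) (C : MConfig) (Z q N' : MCell) (σ u f' v : Fin 4) :
    XresA2IFiresFlat (shiftCfg t C) (shiftCell t Z) (shiftCell t q) (shiftCell t N') σ u f' v ↔ XresA2IFiresFlat C Z q N' σ u f' v := by
  simp only [XresA2IFiresFlat, uPartner_shift, magree_shift, magree2_shift, forall_shiftCfg_upper, ne_eq, shiftCell_apply, isApex_shiftPt,
    ownDir_shiftPt, shiftPt_fst, cabs_shiftPt, add_sub_add_right_eq_sub, add_le_add_iff_right, add_lt_add_iff_right, shiftPt_eq_ray_iff,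
    nullBelow_shiftPt, onULineBelowEq_shiftPt, bsub_shiftPt, (shiftPt_injective t).eq_iff]

/-- … hence so is the flat family. -/
theorem xresA2IClosedFlat_shift (t : ℤ) (C : MConfig) : XresA2IClosedFlat (shiftCfg t C) ↔ XresA2IClosedFlat C := by
  simp only [XresA2IClosedFlat, forall_shiftCfg_lower, forall_shiftCfg_upper, xresA2IFiresFlat_shift]

/-! ## §3 On letters with `α ≥ 0` the clause of record IS the flat clause; `ι_h = (shift by h) ∘ ι₀`; the two certificates -/

/-- on a letter with `α ≥ 0` the encoder direction of record is the own direction (the flipped branch of `EncDir` is void). -/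
theorem encDir_iff_ownDir_of_nonneg {x : BPoint} (hx : 0 ≤ x.1) (u : Fin 4) : EncDir x u ↔ OwnDir x u := by
  have hx' : ¬ x.1 < 0 := not_lt.mpr hx
  show (0 ≤ x.1 ∧ x = ray (x.1 - cabs x, 0, 0) u (cabs x)) ∨ (x.1 < 0 ∧ x = ray (x.1 + cabs x, 0, 0) u (-(cabs x))) ↔
    x = ray (x.1 - cabs x, 0, 0) u (cabs x)
  simp only [hx, hx', true_and, false_and, or_false]

/-- **at a head letter with `α(Z_σ) ≥ 0` the A2I clause OF RECORD and v21's FLAT clause coincide** (same world, same cells, same indices). -/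
theorem xresA2IFires_iff_flat_of_nonneg (C : MConfig) (Z q N' : MCell) (σ u f' v : Fin 4) (hZ : 0 ≤ (Z σ).1) :
    XresA2IFires C Z q N' σ u f' v ↔ XresA2IFiresFlat C Z q N' σ u f' v := by
  have h1 : EncDir (Z σ) u ↔ OwnDir (Z σ) u := encDir_iff_ownDir_of_nonneg hZ u
  have h2 : (0 ≤ (Z σ).1 → (Z σ).1 - (q σ).1 ≤ cabs (Z σ)) ↔ ((Z σ).1 - (q σ).1 ≤ cabs (Z σ)) := ⟨fun h => h hZ, fun h _ => h⟩
  simp only [XresA2IFires, XresA2IFiresFlat, h1, h2]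

theorem dualPt_eq_shift_dualPt_zero (h : ℤ) (x : BPoint) : dualPt h x = shiftPt h (dualPt 0 x) := by
  obtain ⟨a, b, c⟩ := x
  simp only [dualPt, shiftPt, zero_sub, Prod.mk.injEq]
  exact ⟨by ring, trivial⟩

/-- `ι_h Z` is `ι₀ Z` translated up by `h`. -/
theorem dualCell_eq_shift_dualCell_zero (h : ℤ) (Z : MCell) : dualCell h Z = shiftCell h (dualCell 0 Z) := by
  funext f; simp only [dualCell, shiftCell_apply]; exact dualPt_eq_shift_dualPt_zero h (Z f)

/-- `C^{ι_h}` is `C^{ι₀}` translated up by `h`. -/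
theorem dual_eq_shift_dual_zero (h : ℤ) (C : MConfig) : C.dual h = shiftCfg h (C.dual 0) := by
  simp only [MConfig.dual, shiftCfg, Finset.image_image, MConfig.mk.injEq]
  constructor <;> (congr 1; funext X; exact dualCell_eq_shift_dualCell_zero h X)

/-- **CERTIFICATE 1 (LITERAL-WISE).** For a head cell whose `σ`-letter has `α ≤ h`: v21's flat clause fires on `C^{ι₀}` at the ι₀-images of
`(Z; q; N′)` with indices `(σ, u, f′, v)` iff the A2I clause OF RECORD fires on `C^{ι_h}` at the ι_h-images with the SAME indices — i.e. the
instance `gen_a2i_w(make_world(True), flat=True)` emits at `(Z, σ, u, d, f′, v)` is the A♭_h instance at `(Z, σ, u, d, f′, v)`, escapes included. -/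
theorem a2ibFires_iff_aFlatFires (h : ℤ) (C : MConfig) (Z q N' : MCell) (σ u f' v : Fin 4) (hZ : (Z σ).1 ≤ h) :
    XresA2IFiresFlat (C.dual 0) (dualCell 0 Z) (dualCell 0 q) (dualCell 0 N') σ u f' v ↔
      XresA2IFires (C.dual h) (dualCell h Z) (dualCell h q) (dualCell h N') σ u f' v := by
  have h0 : 0 ≤ (shiftCell h (dualCell 0 Z) σ).1 := by show 0 ≤ 0 - (Z σ).1 + h; omega
  rw [dual_eq_shift_dual_zero h C, dualCell_eq_shift_dualCell_zero h Z, dualCell_eq_shift_dualCell_zero h q,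
    dualCell_eq_shift_dualCell_zero h N', xresA2IFires_iff_flat_of_nonneg _ _ _ _ _ _ _ _ h0, xresA2IFiresFlat_shift]

/-- all letters of the support have `α ≤ h` (for a support in ◇_h: `belowHeight_of_inDiamond`). Decidable. -/
abbrev BelowHeight (h : ℤ) (C : MConfig) : Prop := (∀ Z ∈ C.lower, ∀ f, (Z f).1 ≤ h) ∧ ∀ P ∈ C.upper, ∀ f, (P f).1 ≤ h

theorem belowHeight_of_inDiamond {h : ℤ} {C : MConfig} (hC : C.InDiamond h) : BelowHeight h C := by
  refine ⟨fun Z hZ f => ?_, fun P hP f => ?_⟩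
  · have h4 := (hC.1 Z hZ f).2.2.2
    have : 0 ≤ absCharge (Z f) := abs_nonneg _
    omega
  · have h4 := (hC.2 P hP f).2.2.2
    have : 0 ≤ absCharge (P f) := abs_nonneg _
    omega

/-- **CERTIFICATE 2 (FAMILY).** On a support whose letters have `α ≤ h`, v21's family `A2Ib` is CLOSED iff A♭_h := `A2IMinusClosed ∘ ι_h` is:
`JOB_AFLAT=1` adds exactly the A♭_h family of the anomaly lens (LEMMA A∪2I♭ `A2IFlatClosed h`), for every `h` at or above the support's height. -/
theorem a2ibClosed_iff_aFlat (h : ℤ) (C : MConfig) (hC : BelowHeight h C) : A2IbClosed C ↔ A2IMinusClosed (C.dual h) := by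
  show (∀ Z ∈ (C.dual 0).lower, ∀ q ∈ (C.dual 0).upper, ∀ N' ∈ (C.dual 0).lower, ∀ σ u f' v : Fin 4,
      ¬ XresA2IFiresFlat (C.dual 0) Z q N' σ u f' v) ↔
    ∀ Z ∈ (C.dual h).lower, ∀ q ∈ (C.dual h).upper, ∀ N' ∈ (C.dual h).lower, ∀ σ u f' v : Fin 4,
      ¬ XresA2IFires (C.dual h) Z q N' σ u f' v
  rw [dual_eq_shift_dual_zero h C]
  simp only [forall_shiftCfg_lower, forall_shiftCfg_upper]
  refine forall₂_congr fun Z hZ => forall₂_congr fun q _ => forall₂_congr fun N' _ => forall_congr' fun σ =>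
    forall_congr' fun u => forall_congr' fun f' => forall_congr' fun v => not_congr ?_
  have hP : dualCell 0 Z ∈ C.upper := mem_dual_lower.mp hZ
  have hle : (dualCell 0 Z σ).1 ≤ h := hC.2 _ hP σ
  have h0 : 0 ≤ (shiftCell h Z σ).1 := by
    have e : (dualCell 0 Z σ).1 = 0 - (Z σ).1 := rfl
    show 0 ≤ (Z σ).1 + h; omega
  rw [xresA2IFires_iff_flat_of_nonneg _ _ _ _ _ _ _ _ h0, xresA2IFiresFlat_shift]

/-- in particular on supports in ◇_h. -/
theorem a2ibClosed_iff_aFlat_of_inDiamond {h : ℤ} {C : MConfig} (hC : C.InDiamond h) : A2IbClosed C ↔ A2IMinusClosed (C.dual h) :=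
  a2ibClosed_iff_aFlat h C (belowHeight_of_inDiamond hC)

/-- and the choice of `h` does not matter above the support's height: A♭_h = A♭_{h′} there. -/
theorem aFlat_height_indep {h h' : ℤ} {C : MConfig} (hC : BelowHeight h C) (hC' : BelowHeight h' C) :
    A2IMinusClosed (C.dual h) ↔ A2IMinusClosed (C.dual h') := by
  rw [← a2ibClosed_iff_aFlat h C hC, a2ibClosed_iff_aFlat h' C hC']

/-- CONTRAST (why the flag is needed): v20's dual family `A2I⁺ = XresA2IClosed (C.dual 0)` is the clause OF RECORD in the dual-0 world, where every
charged letter has `α < 0`, so `EncDir` takes its FLIPPED branch and the guard is void — NOT the flat clause; the two families differ already on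
the smoke fragment of §4 (`smokeFrag8_v21_probe`: `A2I⁺` closed, `A2Ib` not). Recorded here only as the trivial rewriting of the definitions. -/
theorem a2iPlusClosed_eq (C : MConfig) : A2IPlusClosed C = XresA2IClosed (C.dual 0) := rfl

/-! ## §4 Smoke row in v21's own coordinates (`decide`): on `smokeFrag8` the flag is exactly the difference -/

section Probes

set_option synthInstance.maxSize 8192
set_option synthInstance.maxHeartbeats 2000000

/-- the survivor letter `x = 6I+ℓ_u = (7,1,0)`. -/
def xSmoke : BPoint := ray (6, 0, 0) 0 1

/-- the smoke fragment `{E₋ = {[8I ∣ x ∣ x ∣ x]}, E₊ = {[x]⁴, [8I ∣ 4I+2ℓ_u ∣ x ∣ x]}}` ⊂ ◇₈ (same cells as `AFlatCovariance.smokeFrag8`; encoder JSON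
`{"N": {"n1": [[8,0,0],[7,1,0],[7,1,0],[7,1,0]]}, "P": {"p1": [[7,1,0],[7,1,0],[7,1,0],[7,1,0]], "p2": [[8,0,0],[6,2,0],[7,1,0],[7,1,0]]}}`,
HOME `g5/smokeFrag8.json` 75e4ed50a8675890). -/
def smokeFrag8 : MConfig where
  lower := {mcellOf (8, 0, 0) xSmoke xSmoke xSmoke}
  upper := {mcellOf xSmoke xSmoke xSmoke xSmoke, mcellOf (8, 0, 0) (ray (4, 0, 0) 0 2) xSmoke xSmoke}

/-- `P = [x]⁴`. -/
def smokeP : MCell := mcellOf xSmoke xSmoke xSmoke xSmoke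
/-- `N = [8I ∣ x ∣ x ∣ x]` (the b-leg partner of both heads). -/
def smokeN : MCell := mcellOf (8, 0, 0) xSmoke xSmoke xSmoke
/-- `P″ = [8I ∣ 4I+2ℓ_u ∣ x ∣ x]`. -/
def smokePpp : MCell := mcellOf (8, 0, 0) (ray (4, 0, 0) 0 2) xSmoke xSmoke

/-- **v21 SMOKE ROW** [kernel, `decide`]: (a) the fragment lies in ◇₈ (so §3 applies with `h = 8`); (b) flag OFF: v20's dual family `A2I⁺` is
CLOSED (no kill); (c) flag ON: `A2Ib` is NOT closed; (d) in v21's own dual-0 coordinates the flat clause fires at the ι₀-images of (head `P`;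
`σ = 0`, `u = 2`; partner `N` (b-leg `x ↦ 8I`, `d = 1 = c`); `f′ = 1`, `v = 2`; server `P″`) and of (head `P″`; `σ = 1` (letter `4I+2ℓ_u`, `d = 1 ≤
c = 2`); partner `N`; `f′ = 0`, `v = 2`; server `P`), escapes none; (e) nothing else fires. Expected v21 support-CHECK print on `smokeFrag8.json` with
`JOB_A2I=1 JOB_DUAL=1 JOB_AFLAT=1`: family A2Ib instances 2 (heads `P[6I+l|6I+l|6I+l|6I+l]`, `P[8I|4I+2l|6I+l|6I+l]`, partner column
`N[8I|6I+l|6I+l|6I+l]`, empty escape lists), killed columns = {P, P″} by A2Ib only; flag unset: 0 kills. By `a2ibFires_iff_aFlatFires 8` these are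
the two A♭₈ firings of `AFlatCovariance.smokeFrag8_probe` (d), index for index. -/
theorem smokeFrag8_v21_probe :
    smokeFrag8.InDiamond 8 ∧
    A2IPlusClosed smokeFrag8 ∧
    ¬ A2IbClosed smokeFrag8 ∧
    XresA2IFiresFlat (smokeFrag8.dual 0) (dualCell 0 smokeP) (dualCell 0 smokeN) (dualCell 0 smokePpp) 0 2 1 2 ∧
    XresA2IFiresFlat (smokeFrag8.dual 0) (dualCell 0 smokePpp) (dualCell 0 smokeN) (dualCell 0 smokeP) 1 2 0 2 ∧
    (∀ Z ∈ (smokeFrag8.dual 0).lower, ∀ q ∈ (smokeFrag8.dual 0).upper, ∀ N' ∈ (smokeFrag8.dual 0).lower, ∀ σ u f' v : Fin 4,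
      XresA2IFiresFlat (smokeFrag8.dual 0) Z q N' σ u f' v →
        (Z = dualCell 0 smokeP ∧ N' = dualCell 0 smokePpp ∧ σ = 0 ∧ u = 2 ∧ f' = 1 ∧ v = 2) ∨
        (Z = dualCell 0 smokePpp ∧ N' = dualCell 0 smokeP ∧ σ = 1 ∧ u = 2 ∧ f' = 0 ∧ v = 2)) := by
  refine ⟨by decide +kernel, by decide +kernel, by decide +kernel, by decide +kernel, by decide +kernel, by decide +kernel⟩

/-- the same two firings, transported to A♭₈'s coordinates by CERTIFICATE 1 (no `decide`: `α(P_0) = 7 ≤ 8`, `α(P″_1) = 6 ≤ 8`). -/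
theorem smokeFrag8_v21_fires_as_aFlat8 :
    XresA2IFires (smokeFrag8.dual 8) (dualCell 8 smokeP) (dualCell 8 smokeN) (dualCell 8 smokePpp) 0 2 1 2 ∧
    XresA2IFires (smokeFrag8.dual 8) (dualCell 8 smokePpp) (dualCell 8 smokeN) (dualCell 8 smokeP) 1 2 0 2 :=
  ⟨(a2ibFires_iff_aFlatFires 8 smokeFrag8 smokeP smokeN smokePpp 0 2 1 2 (by decide)).mp smokeFrag8_v21_probe.2.2.2.1,
    (a2ibFires_iff_aFlatFires 8 smokeFrag8 smokePpp smokeN smokeP 1 2 0 2 (by decide)).mp smokeFrag8_v21_probe.2.2.2.2.1⟩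

/-- and the family statement on the fragment through CERTIFICATE 2: `A2Ib` not closed ⇔ A♭₈ not closed (both false here). -/
theorem smokeFrag8_not_aFlat8 : ¬ A2IMinusClosed (smokeFrag8.dual 8) :=
  fun h => smokeFrag8_v21_probe.2.2.1 ((a2ibClosed_iff_aFlat_of_inDiamond smokeFrag8_v21_probe.1).mpr h)

end Probes

end V21

end AnomalyLens

end Summit.Ventures.HSemireg.Pad4Tower
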